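/-
Origin: expansion seat `prover-pub-hodgecm-own-htheta-g2-0`, handover #H17 2026-08-21T06:50Z md5 c9bb3f88690f (288 l.; NEW additive KERNEL leaf beside E — the `_gal` re-cut asked by binder-1-g20 STATUS l.15460 for pub-hodgecm2 own-b01's face-scoped head; imports #H10 `HodgeCM.Model.HThetaJunctionR2B` (← RUN-72 rows #105 #106 #H2 #R131r2) + #H15 `HodgeCM.Model.HsmallOfBlockAtSubCorner` + binder-1-g20 #R133 `HodgeCM.Model.Binders.JLiuSubCornerAdm` (their kit 200d043d1f4c); ROWDEPS #H10 ≺ #H17, #H15 ≺ #H17, #R133 ≺ #H17 — HOLD∕DEFER with #H10's chain; ns HodgeCM.Model (§1–§2) + HodgeCM.Model.SInstance (§3); 6 theorems, 0 defs, nothing cited: THE (J-Liu-Θ) JUNCTION AT THE PIN OF RECORD WITH E's SEXTIC SCOPE CONJUNCTION REMOVED — §1 `hsmall_of_tower_at_block_of_typeOf_gal ∕ _lineType_eq_gal ∕ _isometric_gal` (#H7 §2-tail with `isCorner_of_liftTyped h6 ↦ isSubCorner_of_liftTyped` (#R133) into #H15's sub-corner socket; `h6 ↦ hN : IsNormalClosure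 ℚ c.K L`, Galois-ness from `CMTypeOps.isGaloisRat_of_isNormalClosure`), §2 `hsmall_of_weilFamilyAut_at_block_of_isometric_gal` (axioms-1's indexed instance), §3 **`SInstance.hsmall_ROGT'C_of_thm418C_gal … (h418) (hgood) (hc : GOG V c) (hN : IsNormalClosure ℚ c.K L) (h4 : 4 ≤ Module.finrank ℚ L) (i) : <#H10's conclusion verbatim>`** + consistency `hsmall_ROGT'C_of_thm418C_of_gal` (E's `h6` ⇒ the `_gal` scope by `h6.2.1` and `24 ∨ 48 ⇒ 4 ≤`); a FACE of a Galois sextic with `c.K = L` meets `(hN, h4)` — the hΘ-side head a face-scoped E_F would apply (record-neutral sibling cargo; any E-class head is the coordinator's call); NAMES for audit: HodgeCM.Model.hsmall_of_tower_at_block_of_isometric_gal · HodgeCM.Model.SInstance.hsmall_ROGT'C_of_thm418C_gal · HodgeCM.Model.SInstance.hsmall_ROGT'C_of_thm418C_of_gal) (`HOME/pub-hodgecm-own-htheta/stage73/HodgeCM/Model/HThetaJunctionR2BGal.lean`, md5 c9bb3f88690f, 288 lines);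
landed by the gen-31 packager (p-g31) in gate run 73 as `HodgeCM/Model/HThetaJunctionR2BGal.lean` (verbatim).
-/
/-
Copyright (c) 2026 the pub-hodgecm formalisation cell (harness21).  New file, not vendored.
Origin: ROW-9 OWNER seat `prover-pub-hodgecm-own-htheta-g2-0` (unit pub-hodgecm-own-htheta, gen 2; named single owner of binder row 9 `hΘ` = the (J-Liu-Θ)
junction), 2026-08-21 — the `_gal` RE-CUT of the junction asked by binder-1-g20 (STATUS l.15460) for pub-hodgecm2 own-b01's face-scoped head (lead 1-g87
routing l.15420).  Target in PKG: `HodgeCM/Model/HThetaJunctionR2BGal.lean` (NEW additive KERNEL leaf beside E; imports this seat's #H10 `Model/HThetaJunctionR2B`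
(RUN 73, ← RUN-72 cargo) + #H15 `Model/HsmallOfBlockAtSubCorner` + binder-1-g20's #R133 `Model/Binders/JLiuSubCornerAdm`; nothing imports it; ROWDEPS #H10,
#H15, #R133; drop alone on bounce).  KERNEL ONLY: 5 theorems, 0 defs, nothing cited, no hypothesis kind of E.  Nothing here is a claim of the manuscripts
under adjudication.

WHAT IT IS — THE (J-Liu-Θ) JUNCTION THEOREM AT THE PIN OF RECORD WITH E's SEXTIC SCOPE CONJUNCTION REMOVED.  #H10's
`SInstance.hsmall_ROGT'C_of_thm418C` takes `h6 : finrank ℚ c.K = 6 ∧ IsNormalClosure ℚ c.K L ∧ (finrank ℚ L = 24 ∨ finrank ℚ L = 48)`; it is used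
twice: (a) `4 ≤ finrank ℚ L` for the anisotropy of `V`, (b) the CM-side clause 2 via the ISO corner (`isCorner_of_liftTyped h6`: primitivity of the sextic
corner type).  With clause 2 in SUB-corner form (#H14 ∕ #H15; binder-1-g20 #R132 ∕ #R133: every admissible reflex record is a sub-corner at the lift type,
`L/ℚ` Galois, NO primitivity) the junction needs only `hN : IsNormalClosure ℚ c.K L` ((J4a) at the pin, binder-2 `liftTyped_of_lineType_eq`; Galois-ness
of `L` follows, `CMTypeOps.isGaloisRat_of_isNormalClosure`) and `h4 : 4 ≤ finrank ℚ L`: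
* §1 `hsmall_of_tower_at_block_of_typeOf_gal` ∕ `…_lineType_eq_gal` ∕ `…_isometric_gal` — #H7's §2 tail with `h6 ↦ hN`;
* §2 `hsmall_of_weilFamilyAut_at_block_of_isometric_gal` — over axioms-1's indexed instance of record;
* §3 **`SInstance.hsmall_ROGT'C_of_thm418C_gal … (hN : IsNormalClosure ℚ c.K L) (h4 : 4 ≤ Module.finrank ℚ L) (i : Fin 4)`** — SAME conclusion as #H10's
  junction theorem (E's r20 `hsmall` at `(V, c, i)`), from `h418 := Thm418C` over the pinned dictionary, `hR`, the pin inputs, `GoodCtx`, `GOG`; E's contexts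
  meet `(hN, h4)` a fortiori (`h6.2.1`, `24 ∨ 48 ⇒ 4 ≤`), and so does a FACE of a Galois sextic with `c.K = L` (`L` is a normal closure of itself) — the
  hΘ-side head a face-scoped E_F would apply (pub-hodgecm2 B01; a new E-class head is the coordinator's call, this file is record-neutral sibling cargo).
0 `proof-hole`; expected `#print axioms` ⊆ {propext, Classical.choice, Quot.sound}.
-/
import Summits.HodgeConjecture.HodgeCM.Model.HThetaJunctionR2B
import Summits.HodgeConjecture.HodgeCM.Model.HsmallOfBlockAtSubCorner
import Summits.HodgeConjecture.HodgeCM.Model.Binders.JLiuSubCornerAdm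

set_option autoImplicit false

noncomputable section

open Function Set
open NumberField
open Literature.AlgebraicGeometry.Motives
open Literature.AlgebraicGeometry.ShimuraVarieties
open Literature.AlgebraicGeometry.HodgeTheory
open Literature.NumberTheory.Automorphic
open Literature.NumberTheory.Automorphic.PicardCM
open Literature.NumberTheory.Transcendental (Arapura2012_Cor_15_4_6)

namespace HodgeCM.Model

open HodgeCM.Model.TowerLevel HodgeCM.Model.TowerCarrier HodgeCM.Literature.Theta HodgeCM.Literature.Theta.LiuAlbaneseModuleDatum
open HodgeCM.CMTypeOps (inflate inflate_id)
open HodgeCM.Universe (ThetaModel)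
open HodgeCM.SignRecipe (lineType liftType)

/-! ## §1 Tower-level sockets, one block, clause 2 by SUB-corners, scope `IsNormalClosure ℚ c.K L` only -/

section Tower

variable (hHD : exists_isReal_hodgeModel) (hI : hodgePQ_independent_of_hodgeModel)
  (h₁ : BallQuotientUniformised) (h₃ : CMAbelianVarietyRealised)
variable {L : CMField} {ι₁ : L →+* ℂ} (V : HermSpace3 L ι₁)

/-- **… with `PhiMu ∕ adm` READ OFF a type map and clauses 1–2 from (J4a), GALOIS ONLY** (#H7 `hsmall_of_tower_at_block_of_typeOf` with
`isCorner_of_liftTyped h6 ↦ isSubCorner_of_liftTyped` (binder-1 #R133) into #H15's sub-corner socket). [folklore] -/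
theorem hsmall_of_tower_at_block_of_typeOf_gal [IsGalois ℚ L] (hR : DeligneMilne1982_Thm_6_20_full) (hA : Arapura2012_Cor_15_4_6)
    (R : (picardCMUniverse hHD hI h₁ h₃).ThetaModel) (c : SeesawCtx L)
    (Char : Type) (Adm : Char → Type) (Ω : (μ : Char) → Adm μ → Type)
    [∀ μ a, AddCommGroup (Ω μ a)] [∀ μ a, Module ℂ (Ω μ a)] [∀ μ a, Module (adelicAlgebra V) (Ω μ a)]
    [∀ μ a, IsScalarTower ℂ (adelicAlgebra V) (Ω μ a)] (typeOf : Char → CMType L)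
    (h418 : (LiuDictionary.ofTower hHD hI h₁ h₃ hA V Char Adm Ω (fun μ => ι₁ ∈ (typeOf μ).1)
        (fun μ d => d.IsReflexOfTypeG ι₁ (typeOf μ))).Thm418C)
    (hgood : R.GoodCtx ι₁ c) (i : Fin 4)
    (hJ4 : ∃ μ : Char,
        (∃ j : c.K →+* L, ι₁.comp j = c.σ ∧ typeOf μ = liftType false c.K L j ι₁ (c.Ψ i)) ∧
        ∀ (Γ : Level V) (hΓ : Γ.BelowConjThree), ∀ ω ∈ R.Theta V c i Γ,
          ∃ cf : towerLevel hHD hI (ballQuotientUniformisedDatum_of h₁) h₃ hA Γ hΓ,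
            TowerLevel.res hHD hI (ballQuotientUniformisedDatum_of h₁) h₃ hA cf = ω ∧
              (ofLevel hHD hI (ballQuotientUniformisedDatum_of h₁) h₃ hA Γ hΓ cf :
                  (LiuDictionary.ofTower hHD hI h₁ h₃ hA V Char Adm Ω (fun μ => ι₁ ∈ (typeOf μ).1)
                    (fun μ d => d.IsReflexOfTypeG ι₁ (typeOf μ))).H) ∈
                (LiuDictionary.ofTower hHD hI h₁ h₃ hA V Char Adm Ω (fun μ => ι₁ ∈ (typeOf μ).1)
                  (fun μ d => d.IsReflexOfTypeG ι₁ (typeOf μ))).block μ) :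
    ∃ Γ₀ : Level V, ∀ Γ ≤ Γ₀,
      ∃ (M : CMField) (k : c.K →+* M) (σ' : M →+* ℂ), σ'.comp k = c.σ ∧
        R.Theta V c i Γ ⊆ (picardCMUniverse hHD hI h₁ h₃).Uiso Γ M (inflate k (c.Ψ i)) σ' := by
  obtain ⟨μ, hT, hfam⟩ := hJ4
  exact hsmall_of_tower_at_block_of_isSubCorner hHD hI h₁ h₃ V hR hA R c Char Adm Ω (fun μ => ι₁ ∈ (typeOf μ).1)
    (fun μ d => d.IsReflexOfTypeG ι₁ (typeOf μ)) h418 hgood i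
    ⟨μ, self_mem_of_liftTyped (hgood.mem i) hT, fun d hd => isSubCorner_of_liftTyped hT d (by exact hd), hfam⟩

/-- **… slot clause a TYPE EQUATION `Φ^δ(scalar μ) = Φ^δ(a_i)`**, scope `IsNormalClosure ℚ c.K L` only (#H7 `…_of_lineType_eq` with `h6 ↦ hN`;
Galois-ness of `L` from `hN`). [folklore] -/
theorem hsmall_of_tower_at_block_of_lineType_eq_gal (hR : DeligneMilne1982_Thm_6_20_full) (hA : Arapura2012_Cor_15_4_6)
    (R : (picardCMUniverse hHD hI h₁ h₃).ThetaModel) (c : SeesawCtx L)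
    (Char : Type) (Adm : Char → Type) (Ω : (μ : Char) → Adm μ → Type)
    [∀ μ a, AddCommGroup (Ω μ a)] [∀ μ a, Module ℂ (Ω μ a)] [∀ μ a, Module (adelicAlgebra V) (Ω μ a)]
    [∀ μ a, IsScalarTower ℂ (adelicAlgebra V) (Ω μ a)]
    (scalar : Char → L) (hreal : ∀ μ, conjRingHomK L (scalar μ) = scalar μ) (hne : ∀ μ, scalar μ ≠ 0)
    (h418 : (LiuDictionary.ofTower hHD hI h₁ h₃ hA V Char Adm Ω
        (fun μ => ι₁ ∈ (lineType (scalar μ) (hreal μ) (hne μ)).1)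
        (fun μ d => d.IsReflexOfTypeG ι₁ (lineType (scalar μ) (hreal μ) (hne μ)))).Thm418C)
    (hgood : R.GoodCtx ι₁ c) (hrec : SignRecipe.GoodCtx (Model.orientBitι L ι₁) ι₁ c)
    (hN : IsNormalClosure ℚ c.K L) (i : Fin 4)
    (hJS : ∃ μ : Char,
        lineType (scalar μ) (hreal μ) (hne μ) = lineType (c.D.a i) (c.D.a_real i) (c.D.a_ne i) ∧
        ∀ (Γ : Level V) (hΓ : Γ.BelowConjThree), ∀ ω ∈ R.Theta V c i Γ,
          ∃ cf : towerLevel hHD hI (ballQuotientUniformisedDatum_of h₁) h₃ hA Γ hΓ,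
            TowerLevel.res hHD hI (ballQuotientUniformisedDatum_of h₁) h₃ hA cf = ω ∧
              (ofLevel hHD hI (ballQuotientUniformisedDatum_of h₁) h₃ hA Γ hΓ cf :
                  (LiuDictionary.ofTower hHD hI h₁ h₃ hA V Char Adm Ω
                    (fun μ => ι₁ ∈ (lineType (scalar μ) (hreal μ) (hne μ)).1)
                    (fun μ d => d.IsReflexOfTypeG ι₁ (lineType (scalar μ) (hreal μ) (hne μ)))).H) ∈
                (LiuDictionary.ofTower hHD hI h₁ h₃ hA V Char Adm Ω
                  (fun μ => ι₁ ∈ (lineType (scalar μ) (hreal μ) (hne μ)).1)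
                  (fun μ d => d.IsReflexOfTypeG ι₁ (lineType (scalar μ) (hreal μ) (hne μ)))).block μ) :
    ∃ Γ₀ : Level V, ∀ Γ ≤ Γ₀,
      ∃ (M : CMField) (k : c.K →+* M) (σ' : M →+* ℂ), σ'.comp k = c.σ ∧
        R.Theta V c i Γ ⊆ (picardCMUniverse hHD hI h₁ h₃).Uiso Γ M (inflate k (c.Ψ i)) σ' := by
  haveI : IsGalois ℚ L := CMTypeOps.isGaloisRat_of_isNormalClosure hN
  obtain ⟨μ, hμ, hfam⟩ := hJS
  exact hsmall_of_tower_at_block_of_typeOf_gal hHD hI h₁ h₃ V hR hA R c Char Adm Ω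
    (fun μ => lineType (scalar μ) (hreal μ) (hne μ)) h418 hgood i
    ⟨μ, liftTyped_of_lineType_eq scalar hreal hne _ (fun _ => rfl) hN hrec hμ, hfam⟩

/-- **… slot clause an ISOMETRY `∃ z ≠ 0, scalar μ = z z̄ · a_i`**, scope `IsNormalClosure ℚ c.K L` only (#H7 `…_of_isometric` with `h6 ↦ hN`).
[folklore] -/
theorem hsmall_of_tower_at_block_of_isometric_gal (hR : DeligneMilne1982_Thm_6_20_full) (hA : Arapura2012_Cor_15_4_6)
    (R : (picardCMUniverse hHD hI h₁ h₃).ThetaModel) (c : SeesawCtx L)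
    (Char : Type) (Adm : Char → Type) (Ω : (μ : Char) → Adm μ → Type)
    [∀ μ a, AddCommGroup (Ω μ a)] [∀ μ a, Module ℂ (Ω μ a)] [∀ μ a, Module (adelicAlgebra V) (Ω μ a)]
    [∀ μ a, IsScalarTower ℂ (adelicAlgebra V) (Ω μ a)]
    (scalar : Char → L) (hreal : ∀ μ, conjRingHomK L (scalar μ) = scalar μ) (hne : ∀ μ, scalar μ ≠ 0)
    (h418 : (LiuDictionary.ofTower hHD hI h₁ h₃ hA V Char Adm Ω
        (fun μ => ι₁ ∈ (lineType (scalar μ) (hreal μ) (hne μ)).1)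
        (fun μ d => d.IsReflexOfTypeG ι₁ (lineType (scalar μ) (hreal μ) (hne μ)))).Thm418C)
    (hgood : R.GoodCtx ι₁ c) (hrec : SignRecipe.GoodCtx (Model.orientBitι L ι₁) ι₁ c)
    (hN : IsNormalClosure ℚ c.K L) (i : Fin 4)
    (hJS : ∃ μ : Char,
        (∃ z : L, z ≠ 0 ∧ scalar μ = z * conjRingHomK L z * c.D.a i) ∧
        ∀ (Γ : Level V) (hΓ : Γ.BelowConjThree), ∀ ω ∈ R.Theta V c i Γ,
          ∃ cf : towerLevel hHD hI (ballQuotientUniformisedDatum_of h₁) h₃ hA Γ hΓ,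
            TowerLevel.res hHD hI (ballQuotientUniformisedDatum_of h₁) h₃ hA cf = ω ∧
              (ofLevel hHD hI (ballQuotientUniformisedDatum_of h₁) h₃ hA Γ hΓ cf :
                  (LiuDictionary.ofTower hHD hI h₁ h₃ hA V Char Adm Ω
                    (fun μ => ι₁ ∈ (lineType (scalar μ) (hreal μ) (hne μ)).1)
                    (fun μ d => d.IsReflexOfTypeG ι₁ (lineType (scalar μ) (hreal μ) (hne μ)))).H) ∈
                (LiuDictionary.ofTower hHD hI h₁ h₃ hA V Char Adm Ω
                  (fun μ => ι₁ ∈ (lineType (scalar μ) (hreal μ) (hne μ)).1)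
                  (fun μ d => d.IsReflexOfTypeG ι₁ (lineType (scalar μ) (hreal μ) (hne μ)))).block μ) :
    ∃ Γ₀ : Level V, ∀ Γ ≤ Γ₀,
      ∃ (M : CMField) (k : c.K →+* M) (σ' : M →+* ℂ), σ'.comp k = c.σ ∧
        R.Theta V c i Γ ⊆ (picardCMUniverse hHD hI h₁ h₃).Uiso Γ M (inflate k (c.Ψ i)) σ' := by
  obtain ⟨μ, ⟨z, hz, hzeq⟩, hfam⟩ := hJS
  exact hsmall_of_tower_at_block_of_lineType_eq_gal hHD hI h₁ h₃ V hR hA R c Char Adm Ω scalar hreal hne h418 hgood hrec hN i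
    ⟨μ, SignRecipe.lineType_eq_of_isometric hz (c.D.a_real i) (c.D.a_ne i) (hreal μ) (hne μ) hzeq, hfam⟩

end Tower

/-! ## §2 Over axioms-1's indexed instance OF RECORD, scope `IsNormalClosure ℚ c.K L` only -/

section Instance

variable (hHD : exists_isReal_hodgeModel) (hI : hodgePQ_independent_of_hodgeModel)
  (h₁ : BallQuotientUniformised) (h₃ : CMAbelianVarietyRealised) (hA : Arapura2012_Cor_15_4_6)
variable {L : CMField} {ι₁ : (L : Type) →+* ℂ} (V : HermSpace3 L ι₁)
variable {JV : Matrix (Fin 3) (Fin 3) (L : Type)} {TV : Matrix (Fin 3) (Fin 3) ↥(maximalRealSubfield (L : Type))}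
  {δ : (L : Type)} {hcδ : IsCMField.complexConj (L : Type) δ = -δ} {hδ : δ ≠ 0} {d : ↥(maximalRealSubfield (L : Type))}
  {hd : δ * δ = algebraMap _ (L : Type) d} {hV : TV.IsSymm} {hVd : IsUnit TV.det}
  {hJV : JV = TV.map (algebraMap _ (L : Type))}
  (ιV : ↥V.adelicFin →*
    ↥(UnitaryGroup.finAdelic (↥(maximalRealSubfield (L : Type))) (L : Type) (IsCMField.complexConj (L : Type)) 3 JV))
  (I : Type) (line : I → SplitLine JV TV hcδ hδ hd hV hVd hJV)

/-- **E's `hsmall` OVER THE INDEXED INSTANCE OF RECORD FROM ONE BLOCK, slot clause = ISOMETRY, scope `IsNormalClosure ℚ c.K L` only**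
(#H7 §3 with `h6 ↦ hN`). [folklore] -/
theorem hsmall_of_weilFamilyAut_at_block_of_isometric_gal (hR : DeligneMilne1982_Thm_6_20_full)
    (R : (picardCMUniverse hHD hI h₁ h₃).ThetaModel) (c : SeesawCtx L)
    (h418 : (liuDictionaryOfWeilFamilyAut hHD hI h₁ h₃ hA V ιV I line).Thm418C)
    (hgood : R.GoodCtx ι₁ c) (hrec : SignRecipe.GoodCtx (Model.orientBitι L ι₁) ι₁ c)
    (hN : IsNormalClosure ℚ c.K L) (i : Fin 4)
    (hJS : ∃ j : I,
        (∃ z : (L : Type), z ≠ 0 ∧ (line j).scalar = z * conjRingHomK L z * c.D.a i) ∧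
        ∀ (Γ : Level V) (hΓ : Γ.BelowConjThree), ∀ ω ∈ R.Theta V c i Γ,
          ∃ cf : towerLevel hHD hI (ballQuotientUniformisedDatum_of h₁) h₃ hA Γ hΓ,
            TowerLevel.res hHD hI (ballQuotientUniformisedDatum_of h₁) h₃ hA cf = ω ∧
              (ofLevel hHD hI (ballQuotientUniformisedDatum_of h₁) h₃ hA Γ hΓ cf :
                  (liuDictionaryOfWeilFamilyAut hHD hI h₁ h₃ hA V ιV I line).H) ∈
                (liuDictionaryOfWeilFamilyAut hHD hI h₁ h₃ hA V ιV I line).block j) :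
    ∃ Γ₀ : Level V, ∀ Γ ≤ Γ₀,
      ∃ (M : CMField) (k : c.K →+* M) (σ' : M →+* ℂ), σ'.comp k = c.σ ∧
        R.Theta V c i Γ ⊆ (picardCMUniverse hHD hI h₁ h₃).Uiso Γ M (inflate k (c.Ψ i)) σ' :=
  hsmall_of_tower_at_block_of_isometric_gal hHD hI h₁ h₃ V hR hA R c I (fun j => {χ : (line j).CharW // (line j).IsAutChar χ})
    (fun j a => (line j).Ω ιV a.1) (fun j => (line j).scalar) (fun j => (line j).conj_scalar)
    (fun j => (line j).scalar_ne_zero) h418 hgood hrec hN i hJS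

end Instance

end HodgeCM.Model

/-! ## §3 THE JUNCTION AT THE PIN OF RECORD, scope `IsNormalClosure ℚ c.K L ∧ 4 ≤ [L:ℚ]` -/

open NumberField NumberField.InfinitePlace NumberField.mixedEmbedding IsDedekindDomain
open scoped Matrix Classical TensorProduct SchwartzMap
open MulAction
open Literature.Geometry.ComplexHyperbolic.BallModel (U21 x₀ stabilizerEquivK21)
open Literature.NumberTheory.Automorphic.U21 (K21 matA sclD)
open Literature.AlgebraicGeometry.ShimuraVarieties Literature.AlgebraicGeometry.ShimuraVarieties.BallForms
open Literature.AlgebraicGeometry.HodgeTheory Literature.NumberTheory.Automorphic.PicardCM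
open Literature.NumberTheory.Transcendental (Arapura2012_Cor_15_4_6)
open Literature.NumberTheory.Automorphic Literature.NumberTheory.Automorphic.UnitaryGroup Literature.NumberTheory.Weil1964
open Literature.NumberTheory.GelbartRogawski1991 Literature.NumberTheory.GelbartRogawski1991.UnitaryDualPair
open HodgeCM.Adelic HodgeCM.PerL34 HodgeCM.Model.HypCensus HodgeCM.Model.SupplyInstance HodgeCM.Model.ArchSideTerm
open HodgeCM.Model.ThetaSpace HodgeCM.Model.TowerLevel HodgeCM.Model.TowerCarrier HodgeCM.Literature.Theta

namespace HodgeCM.Model.SInstance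

open HodgeCM.Model.ThetaAdelicSide HodgeCM.Model.LiuIndex

variable (hHD : exists_isReal_hodgeModel) (hI : hodgePQ_independent_of_hodgeModel)
  (h₁ : BallQuotientUniformised) (h₃ : CMAbelianVarietyRealised) (hA : Arapura2012_Cor_15_4_6)

variable
  (hGR : ∀ {L : CMField} {ι₁ : L →+* ℂ} (V : HermSpace3 L ι₁) (c : SeesawCtx L),
    (cmSplittingDatum (L : Type) finProdFinEquiv (frameD V) (frameD_real V) (frameD_ne V) (dW c.D) (dW_real c.D)
      (dW_ne c.D)).CompatibleSplitting)
  (hGR₀ : ∀ {L : CMField} {ι₁ : L →+* ℂ} (V : HermSpace3 L ι₁) (c : SeesawCtx L),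
    (cmSplittingDatum (L : Type) (e₁) (frameD V) (frameD_real V) (frameD_ne V) (lineVec (L : Type) (dW c.D 0))
      (fun _ => dW_real c.D 0) (fun _ => dW_ne c.D 0)).CompatibleSplitting)
  (hGR₁ : ∀ {L : CMField} {ι₁ : L →+* ℂ} (V : HermSpace3 L ι₁) (c : SeesawCtx L),
    (cmSplittingDatum (L : Type) (e₁) (frameD V) (frameD_real V) (frameD_ne V) (lineVec (L : Type) (dW c.D 1))
      (fun _ => dW_real c.D 1) (fun _ => dW_ne c.D 1)).CompatibleSplitting)
  (hGR₂ : ∀ {L : CMField} {ι₁ : L →+* ℂ} (V : HermSpace3 L ι₁) (c : SeesawCtx L),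
    (cmSplittingDatum (L : Type) (e₁) (frameD V) (frameD_real V) (frameD_ne V) (lineVec (L : Type) (dW' c.D 0))
      (fun _ => dW'_real c.D 0) (fun _ => dW'_ne c.D 0)).CompatibleSplitting)
  (hGR₃ : ∀ {L : CMField} {ι₁ : L →+* ℂ} (V : HermSpace3 L ι₁) (c : SeesawCtx L),
    (cmSplittingDatum (L : Type) (e₁) (frameD V) (frameD_real V) (frameD_ne V) (lineVec (L : Type) (dW' c.D 1))
      (fun _ => dW'_real c.D 1) (fun _ => dW'_ne c.D 1)).CompatibleSplitting)
  (μ : ∀ {L : CMField}, SeesawCtx L → Fin 4 → NumberField.InfinitePlace (L : Type) → ℤ)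
  (hΔ₁ : ∀ {L : CMField} {ι₁ : L →+* ℂ} (V : HermSpace3 L ι₁) (c : SeesawCtx L), ∀ hc : GOG V c,
    slotTypeVec V c (hGR V c) (hGR₀ V c) (hGR₁ V c) (hGR₂ V c) (hGR₃ V c) (hG_GOG V c hc) 1 -
      slotTypeVec V c (hGR V c) (hGR₀ V c) (hGR₁ V c) (hGR₂ V c) (hGR₃ V c) (hG_GOG V c hc) 0 = μ c 1 - μ c 0)
  (hΔ₂ : ∀ {L : CMField} {ι₁ : L →+* ℂ} (V : HermSpace3 L ι₁) (c : SeesawCtx L), ∀ hc : GOG V c,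
    slotTypeVec V c (hGR V c) (hGR₀ V c) (hGR₁ V c) (hGR₂ V c) (hGR₃ V c) (hG_GOG V c hc) 2 -
      slotTypeVec V c (hGR V c) (hGR₀ V c) (hGR₁ V c) (hGR₂ V c) (hGR₃ V c) (hG_GOG V c hc) 0 = μ c 2 - μ c 0)
  (hΔ₃ : ∀ {L : CMField} {ι₁ : L →+* ℂ} (V : HermSpace3 L ι₁) (c : SeesawCtx L), ∀ hc : GOG V c,
    slotTypeVec V c (hGR V c) (hGR₀ V c) (hGR₁ V c) (hGR₂ V c) (hGR₃ V c) (hG_GOG V c hc) 3 -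
      slotTypeVec V c (hGR V c) (hGR₀ V c) (hGR₁ V c) (hGR₂ V c) (hGR₃ V c) (hG_GOG V c hc) 0 = μ c 3 - μ c 0)

variable {L : CMField} {ι₁ : L →+* ℂ} (V : HermSpace3 L ι₁) (c : SeesawCtx L)

/-- **THE (J-Liu-Θ) JUNCTION THEOREM AT THE PIN OF RECORD R2 FROM `Thm418C` ALONE — E's SEXTIC SCOPE CONJUNCTION REMOVED.**  Same statement as
#H10 `hsmall_ROGT'C_of_thm418C` with `h6 : finrank ℚ c.K = 6 ∧ IsNormalClosure ℚ c.K L ∧ (finrank ℚ L = 24 ∨ 48)` replaced by what the proof uses: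
`hN : IsNormalClosure ℚ c.K L` ((J4a) at the pin; `L/ℚ` Galois follows) and `h4 : 4 ≤ finrank ℚ L` (anisotropy of `V`).  CM side by SUB-corners
(#H14 ∕ #H15 ∕ binder-1 #R132–#R133), so no primitivity of the corner type is needed — the form a face of a Galois sextic (`c.K = L`) can meet.
[folklore] -/
theorem hsmall_ROGT'C_of_thm418C_gal (hR : DeligneMilne1982_Thm_6_20_full)
    (R : (picardCMUniverse hHD hI h₁ h₃).ThetaModel)
    (hRΘ : ∀ (i : Fin 4) (Γ : Level V), R.Theta V c i Γ ⊆
      thetaOf _ (thetaClassInputOf _ (fun V c => thetaSpaceInputOf hHD hI h₁ h₃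
        (SROGT'C @hGR @hGR₀ @hGR₁ @hGR₂ @hGR₃ @μ hΔ₁ hΔ₂ hΔ₃) V c)) V c i Γ)
    (h418 : ∀ a₀ : LiuIndex.RealScalar L,
      (liuDictionaryPin hHD hI h₁ h₃ hA V (LiuIndex.I V (LiuIndex.repAt a₀) (muLiu ι₁ LiuIndex.GramClass.rep))
          (LiuIndex.line V (LiuIndex.repAt a₀) (muLiu ι₁ LiuIndex.GramClass.rep))).Thm418C)
    (hgood : R.GoodCtx ι₁ c) (hc : GOG V c)
    (hN : IsNormalClosure ℚ c.K L) (h4 : 4 ≤ Module.finrank ℚ L)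
    (i : Fin 4) :
    ∃ Γ₀ : Level V, ∀ Γ ≤ Γ₀,
      ∃ (M : CMField) (k : c.K →+* M) (σ' : M →+* ℂ), σ'.comp k = c.σ ∧
        R.Theta V c i Γ ⊆ (picardCMUniverse hHD hI h₁ h₃).Uiso Γ M (CMTypeOps.inflate k (c.Ψ i)) σ' := by
  have hV : IsAnisotropic L V.Hm := HermSpace3.isAnisotropic V h4
  obtain ⟨j, hj, hfam⟩ := hJ_ROGT'C_block hHD hI h₁ h₃ hA @hGR @hGR₀ @hGR₁ @hGR₂ @hGR₃ @μ hΔ₁ hΔ₂ hΔ₃ V c hc hV i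
  exact hsmall_of_weilFamilyAut_at_block_of_isometric_gal hHD hI h₁ h₃ hA V (ιVE V) _ _ hR R c
    (h418 ⟨c.D.a i, c.D.a_real i, c.D.a_ne i⟩) hgood hc.2 hN i ⟨j, hj, fun Γ hΓ ω hω => hfam Γ hΓ ω (hRΘ i Γ hω)⟩

/-- E's scope implies the `_gal` scope: #H10's junction theorem is ONE application of the `_gal` form (consistency check). [folklore] -/
theorem hsmall_ROGT'C_of_thm418C_of_gal (hR : DeligneMilne1982_Thm_6_20_full)
    (R : (picardCMUniverse hHD hI h₁ h₃).ThetaModel)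
    (hRΘ : ∀ (i : Fin 4) (Γ : Level V), R.Theta V c i Γ ⊆
      thetaOf _ (thetaClassInputOf _ (fun V c => thetaSpaceInputOf hHD hI h₁ h₃
        (SROGT'C @hGR @hGR₀ @hGR₁ @hGR₂ @hGR₃ @μ hΔ₁ hΔ₂ hΔ₃) V c)) V c i Γ)
    (h418 : ∀ a₀ : LiuIndex.RealScalar L,
      (liuDictionaryPin hHD hI h₁ h₃ hA V (LiuIndex.I V (LiuIndex.repAt a₀) (muLiu ι₁ LiuIndex.GramClass.rep))
          (LiuIndex.line V (LiuIndex.repAt a₀) (muLiu ι₁ LiuIndex.GramClass.rep))).Thm418C)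
    (hgood : R.GoodCtx ι₁ c) (hc : GOG V c)
    (h6 : Module.finrank ℚ c.K = 6 ∧ IsNormalClosure ℚ c.K L ∧ (Module.finrank ℚ L = 24 ∨ Module.finrank ℚ L = 48))
    (i : Fin 4) :
    ∃ Γ₀ : Level V, ∀ Γ ≤ Γ₀,
      ∃ (M : CMField) (k : c.K →+* M) (σ' : M →+* ℂ), σ'.comp k = c.σ ∧
        R.Theta V c i Γ ⊆ (picardCMUniverse hHD hI h₁ h₃).Uiso Γ M (CMTypeOps.inflate k (c.Ψ i)) σ' :=
  hsmall_ROGT'C_of_thm418C_gal hHD hI h₁ h₃ hA @hGR @hGR₀ @hGR₁ @hGR₂ @hGR₃ @μ hΔ₁ hΔ₂ hΔ₃ V c hR R hRΘ h418 hgood hc h6.2.1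
    (by rcases h6.2.2 with h | h <;> omega) i

end HodgeCM.Model.SInstance

end
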